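import Summits.Ventures.DiscreteObjects.PP12.OrderElevenTriangleFrame

/-!
# PP(12), order-11 cell, Case B (triangle): incidence lemmas of the frame (kernel; proofs)
Framing: lottery ticket; floor = certified bounds/negative ranges.

Cell pub-namedobj (venture DiscreteObjects), target (M), designs gen 16. Setting and notation of `OrderElevenTriangleFrame` (vertices `v_k`,
sides `S_k`, base side points `Q_k ∈ S_k`, pencil base lines `M_k = v_k Q_k`, free base points `P_t`, free base lines `B_s ∋ Q_0`, free
points `freePts`). Proved here: the vertices off each `M_k`; `M_k` is moved by every `σ^k`, `11 ∤ k` (`pow_pm_ne`); the points of `M_k`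
other than `v_k, Q_k` are free (`free_of_mem_pm0/1/2`); the orbit of `Q_k` stays on `S_k`, off the vertices and off the free points, and
`Q_k` is moved by all powers; `B_s` is vertex-free (`fb11_mem_freeLns`), moved by all powers, `≠` every side, and meets `S_0`, `M_0`,
`B_{s'}` only in `Q_0`; `Q_0 ∈ σ^δ B_{s'}` forces `11 ∣ δ`. Proofs only; nothing asserts any census statement. No `sorry`, no new axioms.
-/

namespace Summit.Ventures.DiscreteObjects.PP12

open Configuration Finset
open scoped Classical

namespace Collineation

variable {P L : Type*} [Membership P L] (σ : Collineation P L) [ProjectivePlane P L] [Fintype P] [Fintype L]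

section ElevenB

variable (h12 : ProjectivePlane.order P L = 12) (hq : σ.onPoints ^ 11 = 1)
  (hB : ∀ l : L, σ.onLines l = l → ∀ [DecidablePred (· ∈ l)], σ.fixedOnLine l = 2)

/-! ### Incidence facts of the frame -/

/-- `v2 ∉ M_0` -/
theorem tv2_not_mem_pm0 : σ.tv2 h12 hq hB ∉ σ.pm0 h12 hq hB := fun h => by
  have e : σ.pm0 h12 hq hB = σ.sd1 h12 hq hB := (Nondegenerate.eq_or_eq (σ.pm_mem h12 hq hB).1 h
    (σ.tv_mem_sd h12 hq hB).2.2.1 (σ.tv_mem_sd h12 hq hB).2.2.2.1).resolve_left (σ.tv_spec h12 hq hB).2.2.2.2.1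
  have t := (σ.pm_mem h12 hq hB).2.1
  rw [e] at t
  exact (σ.sq0_spec h12 hq hB).2.2 (σ.eq_tv2_of_mem_sd0_sd1 h12 hq hB (σ.sq0_spec h12 hq hB).1 t)

/-- `v0 ∉ M_1` -/
theorem tv0_not_mem_pm1 : σ.tv0 h12 hq hB ∉ σ.pm1 h12 hq hB := fun h => by
  have e : σ.pm1 h12 hq hB = σ.sd2 h12 hq hB := (Nondegenerate.eq_or_eq h (σ.pm_mem h12 hq hB).2.2.1
    (σ.tv_mem_sd h12 hq hB).2.2.2.2.1 (σ.tv_mem_sd h12 hq hB).2.2.2.2.2).resolve_left (σ.tv_spec h12 hq hB).2.2.2.1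
  have t := (σ.pm_mem h12 hq hB).2.2.2.1
  rw [e] at t
  exact (σ.sq1_spec h12 hq hB).2.1 (σ.eq_tv0_of_mem_sd1_sd2 h12 hq hB (σ.sq1_spec h12 hq hB).1 t)

/-- `v2 ∉ M_1` -/
theorem tv2_not_mem_pm1 : σ.tv2 h12 hq hB ∉ σ.pm1 h12 hq hB := fun h => by
  have e : σ.pm1 h12 hq hB = σ.sd0 h12 hq hB := (Nondegenerate.eq_or_eq (σ.pm_mem h12 hq hB).2.2.1 h
    (σ.tv_mem_sd h12 hq hB).1 (σ.tv_mem_sd h12 hq hB).2.1).resolve_left (σ.tv_spec h12 hq hB).2.2.2.2.2.1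
  have t := (σ.pm_mem h12 hq hB).2.2.2.1
  rw [e] at t
  exact (σ.sq1_spec h12 hq hB).2.2 (σ.eq_tv2_of_mem_sd0_sd1 h12 hq hB t (σ.sq1_spec h12 hq hB).1)

/-- `v0 ∉ M_2` -/
theorem tv0_not_mem_pm2 : σ.tv0 h12 hq hB ∉ σ.pm2 h12 hq hB := fun h => by
  have e : σ.pm2 h12 hq hB = σ.sd1 h12 hq hB := (Nondegenerate.eq_or_eq h (σ.pm_mem h12 hq hB).2.2.2.2.1
    (σ.tv_mem_sd h12 hq hB).2.2.1 (σ.tv_mem_sd h12 hq hB).2.2.2.1).resolve_left (σ.tv_spec h12 hq hB).2.2.2.2.1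
  have t := (σ.pm_mem h12 hq hB).2.2.2.2.2
  rw [e] at t
  exact (σ.sq2_spec h12 hq hB).2.1 (σ.eq_tv0_of_mem_sd1_sd2 h12 hq hB t (σ.sq2_spec h12 hq hB).1)

/-- `v1 ∉ M_2` -/
theorem tv1_not_mem_pm2 : σ.tv1 h12 hq hB ∉ σ.pm2 h12 hq hB := fun h => by
  have e : σ.pm2 h12 hq hB = σ.sd0 h12 hq hB := (Nondegenerate.eq_or_eq h (σ.pm_mem h12 hq hB).2.2.2.2.1
    (σ.tv_mem_sd h12 hq hB).1 (σ.tv_mem_sd h12 hq hB).2.1).resolve_left (σ.tv_spec h12 hq hB).2.2.2.2.2.1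
  have t := (σ.pm_mem h12 hq hB).2.2.2.2.2
  rw [e] at t
  exact (σ.sq2_spec h12 hq hB).2.2 (σ.eq_tv1_of_mem_sd0_sd2 h12 hq hB t (σ.sq2_spec h12 hq hB).1)

/-- the pencil base lines are moved by every `σ^k`, `11 ∤ k` -/
theorem pow_pm_ne {k : ℕ} (hk : ¬ 11 ∣ k) : (σ.onLines ^ k) (σ.pm0 h12 hq hB) ≠ σ.pm0 h12 hq hB ∧
    (σ.onLines ^ k) (σ.pm1 h12 hq hB) ≠ σ.pm1 h12 hq hB ∧ (σ.onLines ^ k) (σ.pm2 h12 hq hB) ≠ σ.pm2 h12 hq hB := by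
  have M := σ.tv_mem_sd h12 hq hB
  have N := σ.pm_mem h12 hq hB
  refine ⟨fun h => ?_, fun h => ?_, fun h => ?_⟩
  · rcases σ.side_of_fixed h12 hq hB (σ.lfixed_of_pow_lfixed hq hk h) with e | e | e
    · exact σ.tv0_not_mem_sd0 h12 hq hB (e ▸ N.1)
    · exact σ.tv2_not_mem_pm0 h12 hq hB (e ▸ M.2.2.2.1)
    · exact σ.tv1_not_mem_pm0 h12 hq hB (e ▸ M.2.2.2.2.2)
  · rcases σ.side_of_fixed h12 hq hB (σ.lfixed_of_pow_lfixed hq hk h) with e | e | e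
    · exact σ.tv2_not_mem_pm1 h12 hq hB (e ▸ M.2.1)
    · exact σ.tv1_not_mem_sd1 h12 hq hB (e ▸ N.2.2.1)
    · exact σ.tv0_not_mem_pm1 h12 hq hB (e ▸ M.2.2.2.2.1)
  · rcases σ.side_of_fixed h12 hq hB (σ.lfixed_of_pow_lfixed hq hk h) with e | e | e
    · exact σ.tv1_not_mem_pm2 h12 hq hB (e ▸ M.1)
    · exact σ.tv0_not_mem_pm2 h12 hq hB (e ▸ M.2.2.1)
    · exact σ.tv2_not_mem_sd2 h12 hq hB (e ▸ N.2.2.2.2.1)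

/-- the points of `M_0` other than `v0, Q_0` are free -/
theorem free_of_mem_pm0 {p : P} (hp : p ∈ σ.pm0 h12 hq hB) (hv : p ≠ σ.tv0 h12 hq hB) (hQ : p ≠ σ.sq0 h12 hq hB) :
    p ∈ σ.freePts h12 hq hB := by
  have M := σ.tv_mem_sd h12 hq hB
  have N := σ.pm_mem h12 hq hB
  rw [mem_freePts]
  refine ⟨fun h => ?_, fun h => ?_, fun h => ?_⟩
  · rcases Nondegenerate.eq_or_eq hp N.2.1 h (σ.sq0_spec h12 hq hB).1 with e | e
    · exact hQ e
    · exact σ.tv0_not_mem_sd0 h12 hq hB (e ▸ N.1)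
  · rcases Nondegenerate.eq_or_eq hp N.1 h M.2.2.1 with e | e
    · exact hv e
    · exact σ.tv2_not_mem_pm0 h12 hq hB (e ▸ M.2.2.2.1)
  · rcases Nondegenerate.eq_or_eq hp N.1 h M.2.2.2.2.1 with e | e
    · exact hv e
    · exact σ.tv1_not_mem_pm0 h12 hq hB (e ▸ M.2.2.2.2.2)

/-- the points of `M_1` other than `v1, Q_1` are free -/
theorem free_of_mem_pm1 {p : P} (hp : p ∈ σ.pm1 h12 hq hB) (hv : p ≠ σ.tv1 h12 hq hB) (hQ : p ≠ σ.sq1 h12 hq hB) :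
    p ∈ σ.freePts h12 hq hB := by
  have M := σ.tv_mem_sd h12 hq hB
  have N := σ.pm_mem h12 hq hB
  rw [mem_freePts]
  refine ⟨fun h => ?_, fun h => ?_, fun h => ?_⟩
  · rcases Nondegenerate.eq_or_eq hp N.2.2.1 h M.1 with e | e
    · exact hv e
    · exact σ.tv2_not_mem_pm1 h12 hq hB (e ▸ M.2.1)
  · rcases Nondegenerate.eq_or_eq hp N.2.2.2.1 h (σ.sq1_spec h12 hq hB).1 with e | e
    · exact hQ e
    · exact σ.tv1_not_mem_sd1 h12 hq hB (e ▸ N.2.2.1)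
  · rcases Nondegenerate.eq_or_eq hp N.2.2.1 h M.2.2.2.2.2 with e | e
    · exact hv e
    · exact σ.tv0_not_mem_pm1 h12 hq hB (e ▸ M.2.2.2.2.1)

/-- the points of `M_2` other than `v2, Q_2` are free -/
theorem free_of_mem_pm2 {p : P} (hp : p ∈ σ.pm2 h12 hq hB) (hv : p ≠ σ.tv2 h12 hq hB) (hQ : p ≠ σ.sq2 h12 hq hB) :
    p ∈ σ.freePts h12 hq hB := by
  have M := σ.tv_mem_sd h12 hq hB
  have N := σ.pm_mem h12 hq hB
  rw [mem_freePts]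
  refine ⟨fun h => ?_, fun h => ?_, fun h => ?_⟩
  · rcases Nondegenerate.eq_or_eq hp N.2.2.2.2.1 h M.2.1 with e | e
    · exact hv e
    · exact σ.tv1_not_mem_pm2 h12 hq hB (e ▸ M.1)
  · rcases Nondegenerate.eq_or_eq hp N.2.2.2.2.1 h M.2.2.2.1 with e | e
    · exact hv e
    · exact σ.tv0_not_mem_pm2 h12 hq hB (e ▸ M.2.2.1)
  · rcases Nondegenerate.eq_or_eq hp N.2.2.2.2.2 h (σ.sq2_spec h12 hq hB).1 with e | e
    · exact hQ e
    · exact σ.tv2_not_mem_sd2 h12 hq hB (e ▸ N.2.2.2.2.1)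

/-- vertices and side points are not free -/
theorem not_free_of_mem_sd {p : P} (h : p ∈ σ.sd0 h12 hq hB ∨ p ∈ σ.sd1 h12 hq hB ∨ p ∈ σ.sd2 h12 hq hB) : p ∉ σ.freePts h12 hq hB := by
  rw [mem_freePts]; tauto

/-- the orbit of `Q_k` stays on `S_k` -/
theorem pow_sq_mem (k : ℕ) : (σ.onPoints ^ k) (σ.sq0 h12 hq hB) ∈ σ.sd0 h12 hq hB ∧ (σ.onPoints ^ k) (σ.sq1 h12 hq hB) ∈ σ.sd1 h12 hq hB ∧
    (σ.onPoints ^ k) (σ.sq2 h12 hq hB) ∈ σ.sd2 h12 hq hB :=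
  ⟨σ.pow_apply_mem_of_fixed (σ.sd_fixed h12 hq hB).1 (σ.sq0_spec h12 hq hB).1 k,
    σ.pow_apply_mem_of_fixed (σ.sd_fixed h12 hq hB).2.1 (σ.sq1_spec h12 hq hB).1 k,
    σ.pow_apply_mem_of_fixed (σ.sd_fixed h12 hq hB).2.2 (σ.sq2_spec h12 hq hB).1 k⟩

/-- the orbits of `Q_k` avoid the free points -/
theorem pow_sq_not_free (k : ℕ) : (σ.onPoints ^ k) (σ.sq0 h12 hq hB) ∉ σ.freePts h12 hq hB ∧
    (σ.onPoints ^ k) (σ.sq1 h12 hq hB) ∉ σ.freePts h12 hq hB ∧ (σ.onPoints ^ k) (σ.sq2 h12 hq hB) ∉ σ.freePts h12 hq hB :=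
  ⟨σ.not_free_of_mem_sd h12 hq hB (Or.inl (σ.pow_sq_mem h12 hq hB k).1),
    σ.not_free_of_mem_sd h12 hq hB (Or.inr (Or.inl (σ.pow_sq_mem h12 hq hB k).2.1)),
    σ.not_free_of_mem_sd h12 hq hB (Or.inr (Or.inr (σ.pow_sq_mem h12 hq hB k).2.2))⟩

/-- `Q_k` is moved by every `σ^k`, `11 ∤ k` -/
theorem pow_sq_ne {k : ℕ} (hk : ¬ 11 ∣ k) : (σ.onPoints ^ k) (σ.sq0 h12 hq hB) ≠ σ.sq0 h12 hq hB ∧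
    (σ.onPoints ^ k) (σ.sq1 h12 hq hB) ≠ σ.sq1 h12 hq hB ∧ (σ.onPoints ^ k) (σ.sq2 h12 hq hB) ≠ σ.sq2 h12 hq hB := by
  have T := σ.tv_spec h12 hq hB
  have M := σ.tv_mem_sd h12 hq hB
  refine ⟨fun h => ?_, fun h => ?_, fun h => ?_⟩
  · rcases T.2.2.2.2.2.2.2 _ (σ.fixed_of_pow_fixed hq hk h) with e | e | e
    · exact σ.tv0_not_mem_sd0 h12 hq hB (e ▸ (σ.sq0_spec h12 hq hB).1)
    · exact (σ.sq0_spec h12 hq hB).2.1 e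
    · exact (σ.sq0_spec h12 hq hB).2.2 e
  · rcases T.2.2.2.2.2.2.2 _ (σ.fixed_of_pow_fixed hq hk h) with e | e | e
    · exact (σ.sq1_spec h12 hq hB).2.1 e
    · exact σ.tv1_not_mem_sd1 h12 hq hB (e ▸ (σ.sq1_spec h12 hq hB).1)
    · exact (σ.sq1_spec h12 hq hB).2.2 e
  · rcases T.2.2.2.2.2.2.2 _ (σ.fixed_of_pow_fixed hq hk h) with e | e | e
    · exact (σ.sq2_spec h12 hq hB).2.1 e
    · exact (σ.sq2_spec h12 hq hB).2.2 e
    · exact σ.tv2_not_mem_sd2 h12 hq hB (e ▸ (σ.sq2_spec h12 hq hB).1)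

/-- the orbit of `Q_1` avoids `v0, v2`; the orbit of `Q_2` avoids `v0, v1` -/
theorem pow_sq_ne_tv (k : ℕ) : (σ.onPoints ^ k) (σ.sq1 h12 hq hB) ≠ σ.tv0 h12 hq hB ∧ (σ.onPoints ^ k) (σ.sq1 h12 hq hB) ≠ σ.tv2 h12 hq hB ∧
    (σ.onPoints ^ k) (σ.sq2 h12 hq hB) ≠ σ.tv0 h12 hq hB ∧ (σ.onPoints ^ k) (σ.sq2 h12 hq hB) ≠ σ.tv1 h12 hq hB := by
  have T := σ.tv_spec h12 hq hB
  refine ⟨fun h => (σ.sq1_spec h12 hq hB).2.1 ?_, fun h => (σ.sq1_spec h12 hq hB).2.2 ?_, fun h => (σ.sq2_spec h12 hq hB).2.1 ?_,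
    fun h => (σ.sq2_spec h12 hq hB).2.2 ?_⟩
  · exact (σ.onPoints ^ k).injective (h.trans (Equiv.Perm.pow_apply_eq_self_of_apply_eq_self T.1 k).symm)
  · exact (σ.onPoints ^ k).injective (h.trans (Equiv.Perm.pow_apply_eq_self_of_apply_eq_self T.2.2.1 k).symm)
  · exact (σ.onPoints ^ k).injective (h.trans (Equiv.Perm.pow_apply_eq_self_of_apply_eq_self T.1 k).symm)
  · exact (σ.onPoints ^ k).injective (h.trans (Equiv.Perm.pow_apply_eq_self_of_apply_eq_self T.2.1 k).symm)

/-- **`B_s` is vertex-free** -/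
theorem fb11_mem_freeLns (s : Fin 11) : σ.fb11 h12 hq hB s ∈ σ.freeLns h12 hq hB := by
  have S := σ.fb11_spec h12 hq hB s
  have Q := σ.sq0_spec h12 hq hB
  have M := σ.tv_mem_sd h12 hq hB
  rw [mem_freeLns]
  refine ⟨fun h => S.2.2 ?_, fun h => S.2.1 ?_, fun h => S.2.1 ?_⟩
  · exact (Nondegenerate.eq_or_eq h S.1 (σ.pm_mem h12 hq hB).1 (σ.pm_mem h12 hq hB).2.1).resolve_left (σ.tv_ne_sq h12 hq hB).1
  · exact (Nondegenerate.eq_or_eq h S.1 M.1 Q.1).resolve_left (Ne.symm Q.2.1)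
  · exact (Nondegenerate.eq_or_eq h S.1 M.2.1 Q.1).resolve_left (Ne.symm Q.2.2)

/-- `B_s` is moved by every `σ^k`, `11 ∤ k` -/
theorem pow_fb11_ne {k : ℕ} (hk : ¬ 11 ∣ k) (s : Fin 11) : (σ.onLines ^ k) (σ.fb11 h12 hq hB s) ≠ σ.fb11 h12 hq hB s :=
  σ.pow_apply_ne_of_lnFree h12 hq hB hk (σ.fb11_mem_freeLns h12 hq hB s)

/-- `B_s ≠ S_k` -/
theorem fb11_ne_sd (s : Fin 11) : σ.fb11 h12 hq hB s ≠ σ.sd0 h12 hq hB ∧ σ.fb11 h12 hq hB s ≠ σ.sd1 h12 hq hB ∧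
    σ.fb11 h12 hq hB s ≠ σ.sd2 h12 hq hB := by
  have F := σ.fb11_mem_freeLns h12 hq hB s
  rw [mem_freeLns] at F
  have M := σ.tv_mem_sd h12 hq hB
  exact ⟨fun h => F.2.1 (h ▸ M.1), fun h => F.1 (h ▸ M.2.2.1), fun h => F.1 (h ▸ M.2.2.2.2.1)⟩

/-- `B_s ∩ S_0 = {Q_0}` -/
theorem eq_sq0_of_mem_fb11_sd0 (s : Fin 11) {p : P} (h1 : p ∈ σ.fb11 h12 hq hB s) (h2 : p ∈ σ.sd0 h12 hq hB) : p = σ.sq0 h12 hq hB :=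
  (Nondegenerate.eq_or_eq h1 (σ.fb11_spec h12 hq hB s).1 h2 (σ.sq0_spec h12 hq hB).1).resolve_right (σ.fb11_ne_sd h12 hq hB s).1

/-- `B_s ∩ M_0 = {Q_0}` -/
theorem eq_sq0_of_mem_fb11_pm0 (s : Fin 11) {p : P} (h1 : p ∈ σ.fb11 h12 hq hB s) (h2 : p ∈ σ.pm0 h12 hq hB) : p = σ.sq0 h12 hq hB :=
  (Nondegenerate.eq_or_eq h1 (σ.fb11_spec h12 hq hB s).1 h2 (σ.pm_mem h12 hq hB).2.1).resolve_right (σ.fb11_spec h12 hq hB s).2.2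

/-- `B_s ∩ B_{s'} = {Q_0}` for `s ≠ s'` -/
theorem eq_sq0_of_mem_fb11_fb11 {s s' : Fin 11} (hss' : s ≠ s') {p : P} (h1 : p ∈ σ.fb11 h12 hq hB s) (h2 : p ∈ σ.fb11 h12 hq hB s') :
    p = σ.sq0 h12 hq hB :=
  (Nondegenerate.eq_or_eq h1 (σ.fb11_spec h12 hq hB s).1 h2 (σ.fb11_spec h12 hq hB s').1).resolve_right
    fun h => hss' (σ.fb11_injective h12 hq hB h)

/-- a common point of `B_s` and another line lying on `S_0` is `Q_0`; if the other line is `σ^δ` of a free base line, then `11 ∣ δ` -/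
theorem dvd_of_sq0_mem_pow_fb11 {δ : ℕ} {s' : Fin 11} (h : σ.sq0 h12 hq hB ∈ (σ.onLines ^ δ) (σ.fb11 h12 hq hB s')) : 11 ∣ δ := by
  by_contra hδ
  rw [σ.mem_pow_apply_iff] at h
  have h' : (σ.onPoints ^ δ).symm (σ.sq0 h12 hq hB) ∈ σ.sd0 h12 hq hB :=
    σ.pow_symm_apply_mem_of_fixed (σ.sd_fixed h12 hq hB).1 (σ.sq0_spec h12 hq hB).1 δ
  have e := σ.eq_sq0_of_mem_fb11_sd0 h12 hq hB s' h h'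
  have e' : (σ.onPoints ^ δ) (σ.sq0 h12 hq hB) = σ.sq0 h12 hq hB := by
    conv_lhs => rw [← e]
    exact (σ.onPoints ^ δ).apply_symm_apply _
  exact (σ.pow_sq_ne h12 hq hB hδ).1 e'

end ElevenB

end Collineation

end Summit.Ventures.DiscreteObjects.PP12
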